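import Mathlib
import Summits.KontsevichZagierPeriods.KontsevichZagierPeriods.Theorems.SoloInformedKummerHeumanKernel
import HarnessLib
import HarnessLib.Audit

/-!
# Kummer family V: the circular reciprocity law for the third kind, II — profiles and bounds (s41)

Second file of THEOREM XXVIII(b) of the residency paper (§6quattuordecies; file I =
`SoloInformedKummerHeumanKernel`: the potentials `Ψ`, `Ξ`, the rational factors `R`, `S` and the
certificate `S − R = (1 − (1−m)s²) − mx²`).  Here, for the deformation potential
`Ψ(x,s) = (1−m)x²κ(x)·(sW'(s)/D)·κ'(s)` and the kill potential `Ξ(x,s) = (xW(x)/D)·κ(x)·e'(s)`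
(`D = 1 − (1−(1−m)s²)x²`):

* the closed forms with square roots (`W κ = √W`), continuity of `Ψ(x,·)` (for `x² < 1`) and of
  `Ξ(·,s)` on `[0,1]` (for `s ≠ 0`), and the boundary values `Ψ(x,1) = Ξ(0,s) = Ξ(1,s) = 0`;
* the DEFORMED END `Ψ(x,s) = c(s)·((1 − nx²)⁻¹ − 1)κ(x)`, `n = 1 − (1−m)s²`,
  `c(s) = n⁻¹(1−m)sW'(s)κ'(s) = (1−m)s√(1−s²)/√(1−(1−m)s²)` (`= δ₂⁻¹` of Abramowitz–Stegun 17.7.14),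
  and the algebraicity of the scalar `c(s)`;
* the dominations `|R|, |S| ≤ 6/d²` for `0 < d ≤ D` and
  `|F κ(x)κ'(s)| ≤ C(√(1−m))⁻¹(√m)⁻¹(√(1−x))⁻¹(√(1−s))⁻¹` (`|F| ≤ C`, `x, s ∈ [0,1)`), feeding the
  integrability of the two derivatives on the band (file III).

References: M. Abramowitz, I. Stegun, *Handbook of Mathematical Functions*, §17.7;
M. Kontsevich, D. Zagier, *Periods* (2001), §1.2; this work (solo-informed s38, s41).
-/

noncomputable section

open MeasureTheory Set Filter
open scoped Classical

namespace Summit.KontsevichZagierPeriods.KontsevichZagierPeriods.Theorems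

/-! ### Closed forms with square roots, continuity, boundary values -/

/-- `W(z)·κ_μ(z) = √(1−z²)·√(1−μz²)` (`y/√y = √y`). [folklore] -/
theorem soloInformed_kummerHeuman_W_mul_kappa (μ z : ℝ) :
    (1 - z ^ 2) * (1 - μ * z ^ 2) * ((√(1 - z ^ 2))⁻¹ * (√(1 - μ * z ^ 2))⁻¹) =
      √(1 - z ^ 2) * √(1 - μ * z ^ 2) := by
  have h1 : (1 - z ^ 2) * (√(1 - z ^ 2))⁻¹ = √(1 - z ^ 2) := by
    rw [← div_eq_mul_inv, Real.div_sqrt]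
  have h2 : (1 - μ * z ^ 2) * (√(1 - μ * z ^ 2))⁻¹ = √(1 - μ * z ^ 2) := by
    rw [← div_eq_mul_inv, Real.div_sqrt]
  calc (1 - z ^ 2) * (1 - μ * z ^ 2) * ((√(1 - z ^ 2))⁻¹ * (√(1 - μ * z ^ 2))⁻¹)
      = ((1 - z ^ 2) * (√(1 - z ^ 2))⁻¹) * ((1 - μ * z ^ 2) * (√(1 - μ * z ^ 2))⁻¹) := by ring
    _ = √(1 - z ^ 2) * √(1 - μ * z ^ 2) := by rw [h1, h2]

/-- `Ψ(x,s) = (1−m)x²κ(x) · s√(1−s²)√(1−(1−m)s²)/D`. [this work] -/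
theorem soloInformed_kummerHeumanPsi_eq_sqrt (m x s : ℝ) :
    soloInformedKummerHeumanPsi m x s =
      (1 - m) * x ^ 2 * ((√(1 - x ^ 2))⁻¹ * (√(1 - m * x ^ 2))⁻¹) *
        (s * (√(1 - s ^ 2) * √(1 - (1 - m) * s ^ 2)) / (1 - (1 - (1 - m) * s ^ 2) * x ^ 2)) := by
  unfold soloInformedKummerHeumanPsi
  rw [← soloInformed_kummerHeuman_W_mul_kappa (1 - m) s]
  ring

/-- `Ξ(x,s) = (x√(1−x²)√(1−mx²)/D) · (1−(1−m)s²)κ'(s)`. [this work] -/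
theorem soloInformed_kummerHeumanXi_eq_sqrt (m x s : ℝ) :
    soloInformedKummerHeumanXi m x s =
      x * (√(1 - x ^ 2) * √(1 - m * x ^ 2)) / (1 - (1 - (1 - m) * s ^ 2) * x ^ 2) *
        ((1 - (1 - m) * s ^ 2) * ((√(1 - s ^ 2))⁻¹ * (√(1 - (1 - m) * s ^ 2))⁻¹)) := by
  unfold soloInformedKummerHeumanXi
  rw [← soloInformed_kummerHeuman_W_mul_kappa m x]
  ring

/-- `Ψ(x,·)` is continuous (`x² < 1`, `0 < m < 1`). [this work] -/
theorem soloInformed_kummerHeumanPsi_continuous {m x : ℝ} (hm : m ∈ Ioo (0:ℝ) 1) (hx : x ^ 2 < 1) :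
    Continuous (fun s : ℝ => soloInformedKummerHeumanPsi m x s) := by
  have hfun : (fun s : ℝ => soloInformedKummerHeumanPsi m x s) = fun s : ℝ =>
      (1 - m) * x ^ 2 * ((√(1 - x ^ 2))⁻¹ * (√(1 - m * x ^ 2))⁻¹) *
        (s * (√(1 - s ^ 2) * √(1 - (1 - m) * s ^ 2)) / (1 - (1 - (1 - m) * s ^ 2) * x ^ 2)) :=
    funext fun s => soloInformed_kummerHeumanPsi_eq_sqrt m x s
  rw [hfun]
  have hc1 : Continuous fun s : ℝ => √(1 - s ^ 2) :=
    Real.continuous_sqrt.comp (continuous_const.sub (continuous_pow 2))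
  have hc2 : Continuous fun s : ℝ => √(1 - (1 - m) * s ^ 2) :=
    Real.continuous_sqrt.comp (continuous_const.sub (continuous_const.mul (continuous_pow 2)))
  have hnum : Continuous fun s : ℝ => s * (√(1 - s ^ 2) * √(1 - (1 - m) * s ^ 2)) :=
    continuous_id.mul (hc1.mul hc2)
  have hden : Continuous fun s : ℝ => 1 - (1 - (1 - m) * s ^ 2) * x ^ 2 :=
    continuous_const.sub ((continuous_const.sub (continuous_const.mul (continuous_pow 2))).mul
      continuous_const)
  exact continuous_const.mul (hnum.div hden fun s =>
    (soloInformed_kummerHeuman_denom_pos (s := s) hm hx).ne')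

/-- `Ξ(·,s)` is continuous on `[0,1]` (`s ≠ 0`, `0 < m < 1`). [this work] -/
theorem soloInformed_kummerHeumanXi_continuousOn {m s : ℝ} (hm : m ∈ Ioo (0:ℝ) 1) (hs : s ≠ 0) :
    ContinuousOn (fun x : ℝ => soloInformedKummerHeumanXi m x s) (Icc 0 1) := by
  have hfun : (fun x : ℝ => soloInformedKummerHeumanXi m x s) = fun x : ℝ =>
      x * (√(1 - x ^ 2) * √(1 - m * x ^ 2)) / (1 - (1 - (1 - m) * s ^ 2) * x ^ 2) *
        ((1 - (1 - m) * s ^ 2) * ((√(1 - s ^ 2))⁻¹ * (√(1 - (1 - m) * s ^ 2))⁻¹)) :=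
    funext fun x => soloInformed_kummerHeumanXi_eq_sqrt m x s
  rw [hfun]
  have hc1 : Continuous fun x : ℝ => √(1 - x ^ 2) :=
    Real.continuous_sqrt.comp (continuous_const.sub (continuous_pow 2))
  have hc2 : Continuous fun x : ℝ => √(1 - m * x ^ 2) :=
    Real.continuous_sqrt.comp (continuous_const.sub (continuous_const.mul (continuous_pow 2)))
  have hnum : Continuous fun x : ℝ => x * (√(1 - x ^ 2) * √(1 - m * x ^ 2)) :=
    continuous_id.mul (hc1.mul hc2)
  have hden : Continuous fun x : ℝ => 1 - (1 - (1 - m) * s ^ 2) * x ^ 2 :=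
    continuous_const.sub (continuous_const.mul (continuous_pow 2))
  refine (hnum.continuousOn.div hden.continuousOn fun x hx => ?_).mul continuousOn_const
  have hx2 : x ^ 2 ≤ 1 := by
    have : x ^ 2 ≤ 1 ^ 2 := pow_le_pow_left₀ hx.1 hx.2 2
    simpa using this
  exact (soloInformed_kummerHeuman_denom_pos' hm hx2 hs).ne'

/-- `Ψ(x,1) = 0`. [this work] -/
theorem soloInformed_kummerHeumanPsi_right_one (m x : ℝ) : soloInformedKummerHeumanPsi m x 1 = 0 := by
  simp [soloInformedKummerHeumanPsi]

/-- `Ξ(0,s) = 0`. [this work] -/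
theorem soloInformed_kummerHeumanXi_left_zero (m s : ℝ) : soloInformedKummerHeumanXi m 0 s = 0 := by
  simp [soloInformedKummerHeumanXi]

/-- `Ξ(1,s) = 0`. [this work] -/
theorem soloInformed_kummerHeumanXi_left_one (m s : ℝ) : soloInformedKummerHeumanXi m 1 s = 0 := by
  simp [soloInformedKummerHeumanXi]

/-- **The deformed end.**  `Ψ(x,s) = c · ((1 − nx²)⁻¹ − 1) · κ(x)` with `n = 1 − (1−m)s²` and
`c = n⁻¹(1−m)sW'(s)κ'(s)` (`= (1−m)s√(1−s²)/√(1−(1−m)s²) = δ₂⁻¹`): minus the integrand of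
`⟦[pt, c]⟧·(⟦K⟧ − ⟦Π_n⟧)`. [this work] -/
theorem soloInformed_kummerHeumanPsi_end {m x s : ℝ} (hn : 1 - (1 - m) * s ^ 2 ≠ 0)
    (hD : 1 - (1 - (1 - m) * s ^ 2) * x ^ 2 ≠ 0) :
    soloInformedKummerHeumanPsi m x s =
      (1 - (1 - m) * s ^ 2)⁻¹ * ((1 - m) * s * ((1 - s ^ 2) * (1 - (1 - m) * s ^ 2))) *
        ((√(1 - s ^ 2))⁻¹ * (√(1 - (1 - m) * s ^ 2))⁻¹) *
        (((1 - (1 - (1 - m) * s ^ 2) * x ^ 2)⁻¹ - 1) *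
          ((√(1 - x ^ 2))⁻¹ * (√(1 - m * x ^ 2))⁻¹)) := by
  have hfrac : (1 - (1 - (1 - m) * s ^ 2) * x ^ 2)⁻¹ - 1 =
      (1 - (1 - m) * s ^ 2) * x ^ 2 * (1 - (1 - (1 - m) * s ^ 2) * x ^ 2)⁻¹ := by
    linear_combination mul_inv_cancel₀ hD
  have hn2 : (1 - (1 - m) * s ^ 2)⁻¹ * (1 - (1 - m) * s ^ 2) = 1 := inv_mul_cancel₀ hn
  unfold soloInformedKummerHeumanPsi
  rw [hfrac, div_eq_mul_inv]
  linear_combination (-((1 - m) * x ^ 2 * ((√(1 - x ^ 2))⁻¹ * (√(1 - m * x ^ 2))⁻¹) *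
    (s * ((1 - s ^ 2) * (1 - (1 - m) * s ^ 2)) * (1 - (1 - (1 - m) * s ^ 2) * x ^ 2)⁻¹) *
      ((√(1 - s ^ 2))⁻¹ * (√(1 - (1 - m) * s ^ 2))⁻¹))) * hn2

/-- The scalar: `n⁻¹(1−m)sW'(s)κ'(s) = (1−m)s√(1−s²)/√(1−(1−m)s²)`. [folklore] -/
theorem soloInformed_kummerHeuman_scalar_eq {m s : ℝ} (hm : m ∈ Ioo (0:ℝ) 1) (hs : s ∈ Ioo (0:ℝ) 1) :
    (1 - (1 - m) * s ^ 2)⁻¹ * ((1 - m) * s * ((1 - s ^ 2) * (1 - (1 - m) * s ^ 2))) *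
        ((√(1 - s ^ 2))⁻¹ * (√(1 - (1 - m) * s ^ 2))⁻¹) =
      (1 - m) * s * √(1 - s ^ 2) / √(1 - (1 - m) * s ^ 2) := by
  have hm' := soloInformed_kummerHeuman_compl hm
  obtain ⟨h1, h2⟩ := soloInformed_kummerZeta_radicands_pos hm' (b := s) (by nlinarith [hs.1, hs.2])
  have e3 : (1 - (1 - m) * s ^ 2)⁻¹ * √(1 - (1 - m) * s ^ 2) = (√(1 - (1 - m) * s ^ 2))⁻¹ := by
    rw [inv_mul_eq_div, Real.sqrt_div_self]
  calc (1 - (1 - m) * s ^ 2)⁻¹ * ((1 - m) * s * ((1 - s ^ 2) * (1 - (1 - m) * s ^ 2))) *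
        ((√(1 - s ^ 2))⁻¹ * (√(1 - (1 - m) * s ^ 2))⁻¹)
      = (1 - m) * s * ((1 - (1 - m) * s ^ 2)⁻¹ * ((1 - s ^ 2) * (1 - (1 - m) * s ^ 2) *
          ((√(1 - s ^ 2))⁻¹ * (√(1 - (1 - m) * s ^ 2))⁻¹))) := by ring
    _ = (1 - m) * s * ((1 - (1 - m) * s ^ 2)⁻¹ * (√(1 - s ^ 2) * √(1 - (1 - m) * s ^ 2))) := by
        rw [soloInformed_kummerHeuman_W_mul_kappa (1 - m) s]
    _ = (1 - m) * s * √(1 - s ^ 2) * ((1 - (1 - m) * s ^ 2)⁻¹ * √(1 - (1 - m) * s ^ 2)) := by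
        ring
    _ = (1 - m) * s * √(1 - s ^ 2) / √(1 - (1 - m) * s ^ 2) := by
        rw [e3, div_eq_mul_inv]

/-- The scalar `(1−m)s√(1−s²)/√(1−(1−m)s²)` is algebraic for algebraic `m, s ∈ (0,1)`. [folklore] -/
theorem soloInformed_kummerHeuman_scalar_isAlgebraic {m s : ℝ} (hm : m ∈ Ioo (0:ℝ) 1)
    (hma : IsAlgebraic ℚ m) (hs : s ∈ Ioo (0:ℝ) 1) (hsa : IsAlgebraic ℚ s) :
    IsAlgebraic ℚ ((1 - m) * s * √(1 - s ^ 2) / √(1 - (1 - m) * s ^ 2)) := by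
  have hm' := soloInformed_kummerHeuman_compl hm
  obtain ⟨h1, h2⟩ := soloInformed_kummerZeta_radicands_pos hm' (b := s) (by nlinarith [hs.1, hs.2])
  have hma' : IsAlgebraic ℚ (1 - m) := isAlgebraic_one.sub hma
  have hr1 : IsAlgebraic ℚ (√(1 - s ^ 2)) :=
    IsAlgebraic.of_pow two_pos (by rw [Real.sq_sqrt h1.le]; exact isAlgebraic_one.sub (hsa.pow 2))
  have hr2 : IsAlgebraic ℚ (√(1 - (1 - m) * s ^ 2)) :=
    IsAlgebraic.of_pow two_pos (by
      rw [Real.sq_sqrt h2.le]; exact isAlgebraic_one.sub (hma'.mul (hsa.pow 2)))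
  rw [div_eq_mul_inv]
  exact ((hma'.mul hsa).mul hr1).mul hr2.inv

/-! ### Bounds -/

/-- `|1 − 2(1+μ)z² + 3μz⁴| ≤ 4` for `0 < μ < 1`, `z² ≤ 1`. [folklore] -/
theorem soloInformed_kummerHeuman_abs_A_le {μ z : ℝ} (hμ : μ ∈ Ioo (0:ℝ) 1) (hz : z ^ 2 ≤ 1) :
    |1 - 2 * (1 + μ) * z ^ 2 + 3 * μ * z ^ 4| ≤ 4 := by
  have hz0 : 0 ≤ z ^ 2 := sq_nonneg z
  have hz4 : z ^ 4 = z ^ 2 * z ^ 2 := by ring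
  rw [abs_le, hz4]
  constructor <;> nlinarith [hμ.1, hμ.2, mul_nonneg hz0 hz0, mul_le_mul hz hz hz0 zero_le_one]

/-- `|R(x,s)| ≤ 6/d²` whenever `0 < d ≤ D`, `x², s² ≤ 1`, `0 < m < 1`. [this work] -/
theorem soloInformed_kummerHeuman_abs_R_le {m x s d : ℝ} (hm : m ∈ Ioo (0:ℝ) 1) (hx : x ^ 2 ≤ 1)
    (hs : s ^ 2 ≤ 1) (hd : 0 < d) (hdD : d ≤ 1 - (1 - (1 - m) * s ^ 2) * x ^ 2) :
    |soloInformedKummerHeumanR m x s| ≤ 6 / d ^ 2 := by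
  have hm' := soloInformed_kummerHeuman_compl hm
  have hD : 0 < 1 - (1 - (1 - m) * s ^ 2) * x ^ 2 := hd.trans_le hdD
  have hx0 : 0 ≤ x ^ 2 := sq_nonneg x
  have hs0 : 0 ≤ s ^ 2 := sq_nonneg s
  have hR : soloInformedKummerHeumanR m x s =
      (1 - m) * x ^ 2 * ((1 - 2 * (1 + (1 - m)) * s ^ 2 + 3 * (1 - m) * s ^ 4) *
          (1 - (1 - (1 - m) * s ^ 2) * x ^ 2) -
        2 * (1 - m) * s ^ 2 * x ^ 2 * ((1 - s ^ 2) * (1 - (1 - m) * s ^ 2))) /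
        (1 - (1 - (1 - m) * s ^ 2) * x ^ 2) ^ 2 := by
    unfold soloInformedKummerHeumanR
    field_simp
  have hA := soloInformed_kummerHeuman_abs_A_le hm' hs
  have hn0 : 0 ≤ 1 - (1 - m) * s ^ 2 := by nlinarith [hm'.2]
  have hDle : |1 - (1 - (1 - m) * s ^ 2) * x ^ 2| ≤ 1 := by
    rw [abs_of_pos hD]
    nlinarith [mul_nonneg hn0 hx0]
  have hW0 : 0 ≤ (1 - s ^ 2) * (1 - (1 - m) * s ^ 2) :=
    mul_nonneg (by linarith) (by nlinarith [hm'.2])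
  have hW1 : (1 - s ^ 2) * (1 - (1 - m) * s ^ 2) ≤ 1 := by
    calc (1 - s ^ 2) * (1 - (1 - m) * s ^ 2) ≤ 1 * 1 :=
          mul_le_mul (by linarith) (by nlinarith [hm'.1]) (by nlinarith [hm'.2]) zero_le_one
      _ = 1 := one_mul 1
  have hT2 : |2 * (1 - m) * s ^ 2 * x ^ 2 * ((1 - s ^ 2) * (1 - (1 - m) * s ^ 2))| ≤ 2 := by
    have hc : 0 ≤ 2 * (1 - m) * s ^ 2 * x ^ 2 :=
      mul_nonneg (mul_nonneg (mul_nonneg zero_le_two hm'.1.le) hs0) hx0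
    have hc1 : 2 * (1 - m) * s ^ 2 * x ^ 2 ≤ 2 := by
      have h1 : (1 - m) * s ^ 2 ≤ 1 := by nlinarith [hm'.2]
      have h2 : (1 - m) * s ^ 2 * x ^ 2 ≤ 1 := by
        calc (1 - m) * s ^ 2 * x ^ 2 ≤ 1 * 1 :=
              mul_le_mul h1 hx hx0 zero_le_one
          _ = 1 := one_mul 1
      linarith
    rw [abs_of_nonneg (mul_nonneg hc hW0)]
    calc 2 * (1 - m) * s ^ 2 * x ^ 2 * ((1 - s ^ 2) * (1 - (1 - m) * s ^ 2)) ≤ 2 * 1 :=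
          mul_le_mul hc1 hW1 hW0 (by norm_num)
      _ = 2 := by norm_num
  have hnum : |(1 - m) * x ^ 2 * ((1 - 2 * (1 + (1 - m)) * s ^ 2 + 3 * (1 - m) * s ^ 4) *
      (1 - (1 - (1 - m) * s ^ 2) * x ^ 2) -
        2 * (1 - m) * s ^ 2 * x ^ 2 * ((1 - s ^ 2) * (1 - (1 - m) * s ^ 2)))| ≤ 6 := by
    rw [abs_mul]
    have hmx : |(1 - m) * x ^ 2| ≤ 1 := by
      rw [abs_of_nonneg (mul_nonneg hm'.1.le hx0)]
      nlinarith [hm'.2]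
    have hin : |(1 - 2 * (1 + (1 - m)) * s ^ 2 + 3 * (1 - m) * s ^ 4) *
        (1 - (1 - (1 - m) * s ^ 2) * x ^ 2) -
          2 * (1 - m) * s ^ 2 * x ^ 2 * ((1 - s ^ 2) * (1 - (1 - m) * s ^ 2))| ≤ 6 := by
      refine (abs_sub _ _).trans ?_
      rw [abs_mul]
      have : |1 - 2 * (1 + (1 - m)) * s ^ 2 + 3 * (1 - m) * s ^ 4| *
          |1 - (1 - (1 - m) * s ^ 2) * x ^ 2| ≤ 4 * 1 :=
        mul_le_mul hA hDle (abs_nonneg _) (by norm_num)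
      linarith
    calc |(1 - m) * x ^ 2| * |(1 - 2 * (1 + (1 - m)) * s ^ 2 + 3 * (1 - m) * s ^ 4) *
          (1 - (1 - (1 - m) * s ^ 2) * x ^ 2) -
            2 * (1 - m) * s ^ 2 * x ^ 2 * ((1 - s ^ 2) * (1 - (1 - m) * s ^ 2))| ≤ 1 * 6 :=
          mul_le_mul hmx hin (abs_nonneg _) zero_le_one
      _ = 6 := one_mul 6
  rw [hR, abs_div, abs_of_pos (pow_pos hD 2), div_le_div_iff₀ (pow_pos hD 2) (pow_pos hd 2)]
  have hsq : d ^ 2 ≤ (1 - (1 - (1 - m) * s ^ 2) * x ^ 2) ^ 2 := pow_le_pow_left₀ hd.le hdD 2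
  exact mul_le_mul hnum hsq (sq_nonneg _) (by norm_num)

/-- `|S(x,s)| ≤ 6/d²` whenever `0 < d ≤ D`, `x², s² ≤ 1`, `0 < m < 1`. [this work] -/
theorem soloInformed_kummerHeuman_abs_S_le {m x s d : ℝ} (hm : m ∈ Ioo (0:ℝ) 1) (hx : x ^ 2 ≤ 1)
    (hs : s ^ 2 ≤ 1) (hd : 0 < d) (hdD : d ≤ 1 - (1 - (1 - m) * s ^ 2) * x ^ 2) :
    |soloInformedKummerHeumanS m x s| ≤ 6 / d ^ 2 := by
  have hm' := soloInformed_kummerHeuman_compl hm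
  have hD : 0 < 1 - (1 - (1 - m) * s ^ 2) * x ^ 2 := hd.trans_le hdD
  have hx0 : 0 ≤ x ^ 2 := sq_nonneg x
  have hs0 : 0 ≤ s ^ 2 := sq_nonneg s
  have hn0 : 0 ≤ 1 - (1 - m) * s ^ 2 := by nlinarith [hm'.2]
  have hn1 : 1 - (1 - m) * s ^ 2 ≤ 1 := by nlinarith [hm'.1]
  have hS : soloInformedKummerHeumanS m x s =
      (1 - (1 - m) * s ^ 2) * ((1 - 2 * (1 + m) * x ^ 2 + 3 * m * x ^ 4) *
          (1 - (1 - (1 - m) * s ^ 2) * x ^ 2) +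
        2 * (1 - (1 - m) * s ^ 2) * x ^ 2 * ((1 - x ^ 2) * (1 - m * x ^ 2))) /
        (1 - (1 - (1 - m) * s ^ 2) * x ^ 2) ^ 2 := by
    unfold soloInformedKummerHeumanS
    field_simp
  have hA := soloInformed_kummerHeuman_abs_A_le hm hx
  have hDle : |1 - (1 - (1 - m) * s ^ 2) * x ^ 2| ≤ 1 := by
    rw [abs_of_pos hD]
    nlinarith [mul_nonneg hn0 hx0]
  have hW0 : 0 ≤ (1 - x ^ 2) * (1 - m * x ^ 2) :=
    mul_nonneg (by linarith) (by nlinarith [hm.2])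
  have hW1 : (1 - x ^ 2) * (1 - m * x ^ 2) ≤ 1 := by
    calc (1 - x ^ 2) * (1 - m * x ^ 2) ≤ 1 * 1 :=
          mul_le_mul (by linarith) (by nlinarith [hm.1]) (by nlinarith [hm.2]) zero_le_one
      _ = 1 := one_mul 1
  have hT2 : |2 * (1 - (1 - m) * s ^ 2) * x ^ 2 * ((1 - x ^ 2) * (1 - m * x ^ 2))| ≤ 2 := by
    have hc : 0 ≤ 2 * (1 - (1 - m) * s ^ 2) * x ^ 2 :=
      mul_nonneg (mul_nonneg zero_le_two hn0) hx0
    have hc1 : 2 * (1 - (1 - m) * s ^ 2) * x ^ 2 ≤ 2 := by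
      have h2 : (1 - (1 - m) * s ^ 2) * x ^ 2 ≤ 1 := by
        calc (1 - (1 - m) * s ^ 2) * x ^ 2 ≤ 1 * 1 := mul_le_mul hn1 hx hx0 zero_le_one
          _ = 1 := one_mul 1
      linarith
    rw [abs_of_nonneg (mul_nonneg hc hW0)]
    calc 2 * (1 - (1 - m) * s ^ 2) * x ^ 2 * ((1 - x ^ 2) * (1 - m * x ^ 2)) ≤ 2 * 1 :=
          mul_le_mul hc1 hW1 hW0 (by norm_num)
      _ = 2 := by norm_num
  have hnum : |(1 - (1 - m) * s ^ 2) * ((1 - 2 * (1 + m) * x ^ 2 + 3 * m * x ^ 4) *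
      (1 - (1 - (1 - m) * s ^ 2) * x ^ 2) +
        2 * (1 - (1 - m) * s ^ 2) * x ^ 2 * ((1 - x ^ 2) * (1 - m * x ^ 2)))| ≤ 6 := by
    rw [abs_mul]
    have hnn : |1 - (1 - m) * s ^ 2| ≤ 1 := by rw [abs_of_nonneg hn0]; exact hn1
    have hin : |(1 - 2 * (1 + m) * x ^ 2 + 3 * m * x ^ 4) * (1 - (1 - (1 - m) * s ^ 2) * x ^ 2) +
        2 * (1 - (1 - m) * s ^ 2) * x ^ 2 * ((1 - x ^ 2) * (1 - m * x ^ 2))| ≤ 6 := by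
      refine (abs_add_le _ _).trans ?_
      rw [abs_mul]
      have : |1 - 2 * (1 + m) * x ^ 2 + 3 * m * x ^ 4| * |1 - (1 - (1 - m) * s ^ 2) * x ^ 2| ≤
          4 * 1 := mul_le_mul hA hDle (abs_nonneg _) (by norm_num)
      linarith
    calc |1 - (1 - m) * s ^ 2| * |(1 - 2 * (1 + m) * x ^ 2 + 3 * m * x ^ 4) *
          (1 - (1 - (1 - m) * s ^ 2) * x ^ 2) +
            2 * (1 - (1 - m) * s ^ 2) * x ^ 2 * ((1 - x ^ 2) * (1 - m * x ^ 2))| ≤ 1 * 6 :=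
          mul_le_mul hnn hin (abs_nonneg _) zero_le_one
      _ = 6 := one_mul 6
  rw [hS, abs_div, abs_of_pos (pow_pos hD 2), div_le_div_iff₀ (pow_pos hD 2) (pow_pos hd 2)]
  have hsq : d ^ 2 ≤ (1 - (1 - (1 - m) * s ^ 2) * x ^ 2) ^ 2 := pow_le_pow_left₀ hd.le hdD 2
  exact mul_le_mul hnum hsq (sq_nonneg _) (by norm_num)

/-- **Domination.**  `|F κ(x) κ'(s)| ≤ C (√(1−m))⁻¹(√m)⁻¹ · (√(1−x))⁻¹(√(1−s))⁻¹` for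
`x, s ∈ [0,1)` whenever `|F| ≤ C`. [this work] -/
theorem soloInformed_kummerHeuman_kernel_le {m x s F C : ℝ} (hm : m ∈ Ioo (0:ℝ) 1)
    (hx : x ∈ Ico (0:ℝ) 1) (hs : s ∈ Ico (0:ℝ) 1) (hF : |F| ≤ C) (hC : 0 ≤ C) :
    |F * ((√(1 - x ^ 2))⁻¹ * (√(1 - m * x ^ 2))⁻¹) *
        ((√(1 - s ^ 2))⁻¹ * (√(1 - (1 - m) * s ^ 2))⁻¹)| ≤
      C * ((√(1 - m))⁻¹ * (√m)⁻¹) * ((√(1 - x))⁻¹ * (√(1 - s))⁻¹) := by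
  have hm' := soloInformed_kummerHeuman_compl hm
  have hκx : 0 ≤ (√(1 - x ^ 2))⁻¹ * (√(1 - m * x ^ 2))⁻¹ := by positivity
  have hκs : 0 ≤ (√(1 - s ^ 2))⁻¹ * (√(1 - (1 - m) * s ^ 2))⁻¹ := by positivity
  rw [abs_mul, abs_mul, abs_of_nonneg hκx, abs_of_nonneg hκs]
  have hA := soloInformed_kummerZeta_kappa_le hm hx
  have hB := soloInformed_kummerZeta_kappa_le hm' hs
  rw [sub_sub_cancel] at hB
  calc |F| * ((√(1 - x ^ 2))⁻¹ * (√(1 - m * x ^ 2))⁻¹) *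
        ((√(1 - s ^ 2))⁻¹ * (√(1 - (1 - m) * s ^ 2))⁻¹)
      ≤ C * ((√(1 - x))⁻¹ * (√(1 - m))⁻¹) * ((√(1 - s))⁻¹ * (√m)⁻¹) :=
        mul_le_mul (mul_le_mul hF hA hκx hC) hB hκs (by positivity)
    _ = C * ((√(1 - m))⁻¹ * (√m)⁻¹) * ((√(1 - x))⁻¹ * (√(1 - s))⁻¹) := by ring

end Summit.KontsevichZagierPeriods.KontsevichZagierPeriods.Theorems
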